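import Summits.BirchSwinnertonDyer.BirchSwinnertonDyer.Theorems.ResidualThetaTransportAtTwoThetaLayerLambdaCongruenceAtTwoCuspSpanRowInduction
import Summits.BirchSwinnertonDyer.BirchSwinnertonDyer.Theorems.ResidualThetaTransportAtTwoThetaLayerLambdaCongruenceAtTwoCuspSpanPotential
import HarnessLib

/-!
# Route `ResidualThetaTransportAtTwo`, cruxes Kan⁺ (stmt-BirchSwinnertonDyer-20688) / node 27436 / 21437: the node
# `CuspSpanEvenAtTwo N` at EVERY ODD LEVEL `N` PRIME TO `3` — primes, prime powers and composite levels alike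

Cell `bsd-wall`, width seat `bsd-wall-rtt-p3-w4` g2 (2026-08-28), memo `Cruxes/ThetaLayerLambdaCongruenceAtTwo/Lines/birth-rows-allodd.md`.
THEOREMS ONLY; `--supports stmt-BirchSwinnertonDyer-20688`; BSD is not proved by this. No certificate, no GRH, no kit.

* §1 `chi_eq_zero_of_odd_row` — every ODD row `b = −m` is killed, by strong induction from `B₁` (`…CuspSpanRowInduction.chi_eq_zero_row_step`);
  `chi_eq_zero_of_forall_b1_odd_not_three` — (G‴)_N: an additive `χ : Γ₀(N) → 𝔽₂` killing the small-trace elements, the `|d| = 4^k` elements and the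
  row `b = −1` vanishes identically (parity: `b > 0` via `γ⁻¹`, `b` even via `γT`, `b = 0` is `±L^c`).
* §2 **`cuspSpanEvenAtTwo_odd_of_not_three_dvd : Odd N → ¬ 3 ∣ N → CuspSpanEvenAtTwo N`** (through `…CuspSpanCharacterOdd.
  cuspSpanEvenAtTwo_of_forall_b1_odd`, p638351), and FLAT for every `W` good supersingular at `2` with `a₂ = 0` whose conductor is odd
  and prime to `3`. The case `3 ∣ N` needs one more variant of the CRT step (memo §4, `z ≡ 2 (mod 3)`): sequel.

Inputs (all kernel): the three-fold `B₁`-product relation at every odd level (p636849; device of rtt-p3-w2 g4), rtt-p3-w5 g2's two-fold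
products (`…FourInvarianceOdd`), the `F`-character theorem (p638351), the row conjugation `χ ∘ Ad(diag(m,1))` (p640615), the row relations
(p640993), Dirichlet / CRT / quadratic reciprocity / Hensel from Mathlib. References: [Rademacher1929] §1; [Knapp1993] Prop. 11.1;
[Manin1972] §1.5; [Pollack2003] Conj. 6.3, Prop. 6.18.
-/

set_option autoImplicit false
set_option linter.dupNamespace false

noncomputable section

open scoped MatrixGroups

open CongruenceSubgroup WeierstrassCurve Literature.NumberTheory.EllipticCurves
  Literature.NumberTheory.EllipticCurves.ModularForms Literature.NumberTheory.EllipticCurves.Rank1Residual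
  Literature.NumberTheory.IwasawaTheory Summit.BirchSwinnertonDyer.Rank1Residual.Supersingular

namespace Summit.BirchSwinnertonDyer.BirchSwinnertonDyer.Theorems.SignedMuAtTwo

variable {N : ℕ} {χ : Gamma0 N → ZMod 2}

/-! ## §1. All odd rows; (G‴)_N -/

/-- **Every odd row `b = −m` is killed** (`N` odd, `3 ∤ N`). [cite: Pollack2003, Conj. 6.3] -/
theorem chi_eq_zero_of_odd_row (hN : Odd N) (h3N : ¬ 3 ∣ N)
    (hadd : ∀ γ δ : Gamma0 N, χ (γ * δ) = χ γ + χ δ)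
    (hsmall : ∀ γ : Gamma0 N, ((γ : SL(2, ℤ)) 0 0 + (γ : SL(2, ℤ)) 1 1).natAbs ≤ 2 → χ γ = 0)
    (hkill : ∀ γ : Gamma0 N, (∃ k : ℕ, 1 ≤ k ∧ ((γ : SL(2, ℤ)) 1 1).natAbs = 4 ^ k) → χ γ = 0)
    (hB1 : ∀ β : Gamma0 N, (β : SL(2, ℤ)) 0 1 = -1 → χ β = 0) :
    ∀ m : ℕ, Odd m → ∀ γ : Gamma0 N, (γ : SL(2, ℤ)) 0 1 = -(m : ℤ) → χ γ = 0 := by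
  intro m
  induction m using Nat.strong_induction_on with
  | _ m ih =>
    intro hm γ hb
    rcases Nat.lt_or_ge m 3 with hlt | hge
    · -- `m = 1`
      obtain ⟨k, hk⟩ := hm
      have : m = 1 := by omega
      subst this
      exact hB1 γ (by rw [hb]; rfl)
    · exact Rows.chi_eq_zero_row_step hN h3N m hm hge hadd hsmall hkill hB1
        (fun t ht htm ↦ ih t htm ht) γ hb

/-- **(G‴)_N for odd `N` prime to `3`.** [cite: Pollack2003, Conj. 6.3] [cite: Rademacher1929, §1] -/
theorem chi_eq_zero_of_forall_b1_odd_not_three (hN : Odd N) (h3N : ¬ 3 ∣ N)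
    (hadd : ∀ γ δ : Gamma0 N, χ (γ * δ) = χ γ + χ δ)
    (hsmall : ∀ γ : Gamma0 N, ((γ : SL(2, ℤ)) 0 0 + (γ : SL(2, ℤ)) 1 1).natAbs ≤ 2 → χ γ = 0)
    (hkill : ∀ γ : Gamma0 N, (∃ k : ℕ, 1 ≤ k ∧ ((γ : SL(2, ℤ)) 1 1).natAbs = 4 ^ k) → χ γ = 0)
    (hB1 : ∀ β : Gamma0 N, (β : SL(2, ℤ)) 0 1 = -1 → χ β = 0) : ∀ γ : Gamma0 N, χ γ = 0 := by
  haveI : NeZero N := ⟨hN.pos.ne'⟩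
  have hrow := chi_eq_zero_of_odd_row hN h3N hadd hsmall hkill hB1
  -- odd `b` of either sign
  have hodd : ∀ γ : Gamma0 N, Odd ((γ : SL(2, ℤ)) 0 1) → χ γ = 0 := by
    intro γ hb
    set b : ℤ := (γ : SL(2, ℤ)) 0 1 with hbdef
    have hbabs : Odd b.natAbs := Int.natAbs_odd.mpr hb
    rcases le_or_gt b 0 with hle | hgt
    · exact hrow b.natAbs hbabs γ (by rw [← hbdef]; omega)
    · rw [← Potential.chi_inv hadd γ]
      refine hrow b.natAbs hbabs γ⁻¹ ?_
      rw [InvMemClass.coe_inv, Matrix.SpecialLinearGroup.SL2_inv_expl]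
      show -((γ : SL(2, ℤ)) 0 1) = _
      rw [← hbdef]; omega
  intro γ
  by_cases hb0 : (γ : SL(2, ℤ)) 0 1 = 0
  · -- `b = 0`: `a d = 1`, trace `±2`
    have hdet := Matrix.SpecialLinearGroup.det_coe (γ : SL(2, ℤ))
    rw [Matrix.det_fin_two, hb0, zero_mul, sub_zero] at hdet
    refine hsmall γ ?_
    rcases Int.eq_one_or_neg_one_of_mul_eq_one' hdet with ⟨ha, hd⟩ | ⟨ha, hd⟩ <;> rw [ha, hd] <;> rfl
  rcases Int.even_or_odd ((γ : SL(2, ℤ)) 0 1) with he | ho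
  · -- `b` even: `γ T` has `b' = a + b` odd (`a` is odd)
    obtain ⟨T, hT00, hT01, hT10, hT11⟩ :=
      ThetaLayerLambdaCongruenceAtTwo.exists_gamma0_entries (N := N) 1 1 0 1 (by ring) (dvd_zero _)
    have hT : χ T = 0 := hsmall T (by rw [hT00, hT11]; decide)
    have hdet := Matrix.SpecialLinearGroup.det_coe (γ : SL(2, ℤ))
    rw [Matrix.det_fin_two] at hdet
    have ha : Odd ((γ : SL(2, ℤ)) 0 0) := by
      have h1 : Odd ((γ : SL(2, ℤ)) 0 0 * (γ : SL(2, ℤ)) 1 1) := by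
        rw [show (γ : SL(2, ℤ)) 0 0 * (γ : SL(2, ℤ)) 1 1 = 1 + (γ : SL(2, ℤ)) 0 1 * (γ : SL(2, ℤ)) 1 0 by
          linear_combination hdet]
        exact odd_one.add_even (he.mul_right _)
      exact (Int.odd_mul.mp h1).1
    have hγT : χ (γ * T) = 0 := hodd _ (by
      rw [gamma0_mul_apply_zero_one, hT01, hT11, mul_one, mul_one]; exact ha.add_even he)
    rw [hadd, hT, add_zero] at hγT
    exact hγT
  · exact hodd γ ho

/-! ## §2. The node at every odd level prime to `3`, and FLAT -/

/-- **`CuspSpanEvenAtTwo N` for every odd `N` with `3 ∤ N`** — primes, prime powers and composite levels. BSD is not proved by this.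
[cite: Pollack2003, Conj. 6.3] [cite: Rademacher1929, §1] [cite: Manin1972, §1.5] -/
theorem cuspSpanEvenAtTwo_odd_of_not_three_dvd [NeZero N] (hN : Odd N) (h3N : ¬ 3 ∣ N) : CuspSpanEvenAtTwo N :=
  cuspSpanEvenAtTwo_of_forall_b1_odd hN fun _ hadd hsmall hkill hB1 ↦ chi_eq_zero_of_forall_b1_odd_not_three hN h3N hadd hsmall hkill hB1

/-- **FLAT for every odd conductor prime to `3`.** For `W/ℚ` good supersingular at `2` with `a₂(W) = 0`, newform `f`, and odd conductor
`N_W` with `3 ∤ N_W`: `2 ∤ L⁻` for every Pollack pair `(L⁺, L⁻)` of `f` at `2`. BSD is not proved by this.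
[cite: Pollack2003, Conj. 6.3 and Prop. 6.18] -/
theorem flatAtTwo_of_conductor_odd_not_three_dvd {W : WeierstrassCurve ℚ} [W.IsElliptic] [W.IsGloballyMinimal]
    [NeZero (W.conductorNorm ℤ)] {f : CuspForm (Gamma0 (W.conductorNorm ℤ)) 2}
    (hf : IsNewformOf W f) (hss : GoodSS W 2) (ha2 : W.frobeniusTrace 2 = 0)
    (hodd : Odd (W.conductorNorm ℤ)) (h3 : ¬ 3 ∣ W.conductorNorm ℤ) :
    ∀ Lplus Lminus : IwasawaAlgebra 2, IsPollackPair f 2 Lplus Lminus → ¬ PowerSeries.C (2 : ℤ_[2]) ∣ Lminus :=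
  flatAtTwo_of_cuspSpanEvenAtTwo hf hss ha2 (cuspSpanEvenAtTwo_odd_of_not_three_dvd hodd h3)

end Summit.BirchSwinnertonDyer.BirchSwinnertonDyer.Theorems.SignedMuAtTwo

end
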